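import Literature.Analysis.FluidPDE.PassiveScalarEnergyProofs
import Literature.Analysis.FluidPDE.PassiveScalarCommutatorSobolev
import Literature.Analysis.Calculus.RenormalizedPrimitive
import Literature.Analysis.Calculus.SmoothTruncation
import Literature.Analysis.FunctionSpaces.TorusTranslationEstimate
import Literature.Analysis.FluidPDE.PassiveScalarRenormalizedSlice
import HarnessLib

/-!
# Energy inequality for the passive scalar with `L² ∩ Ḣ¹` drift (renormalisation)

Analysis/FluidPDE proof-support file (everything proved). For `κ > 0`, `θ₀ ∈ L²(T^d)` and a
weak solution `θ ∈ L^∞(0,T; L²)` of `∂ₜθ + u·∇θ = κΔθ` on `T^d × [0,T)` whose drift satisfies,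
for a.e. `t`, `u(t) ∈ L²(T^d)` and `‖∇u(t)‖²_{L²} = eGradNormSq (u t) ≤ G` (the velocity class of
Seis 2022, Thm. 2 with `p = q = 2`), we prove the energy inequality

  `2κ ∫₀ᵀ ‖∇θ(s)‖²_{L²} ds ≤ ‖θ₀‖²_{L²}`  (`energy_ineq_of_eGradNormSq_le`),

the gradient norm being the spectral `Torus.eScalarGradNormSq`. In particular `θ(s) ∈ H¹` for
a.e. `s`, as used in the proof of Seis 2022, Thm. 2 ("the energy inequality
`κ ∫₀ᵗ ‖∇θ‖²_{L²} dt ≤ ∫ θ₀² dx`", p. 8).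

Proof: DiPerna–Lions renormalisation (DiPerna–Lions 1989, §II.3) of the tree's mollified
equation. With `A_ε = θ ⋆ k_ε` and the smooth renormaliser `β = renorm M` (`β'' = 2(S_M')²`,
`β'` bounded, `0 ≤ β ≤ x²`; `Calculus/SmoothTruncation`):
`∫ β(A_ε(t)) = ∫ β(θ₀ ⋆ k_ε) + ∫₀ᵗ∫ β'(A_ε) G_ε` for a.e. `t` (chain rule along the time primitive,
`Calculus/RenormalizedPrimitive`, and Fubini), and slice-wise
`∫ β'(A_ε) G_ε = ∫ β'(A_ε) r_ε - 2κ ∫ ‖∇(S_M ∘ A_ε)‖²` (`PassiveScalarRenormalizedSlice`), with the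
DiPerna–Lions commutator `r_ε → 0` in `L¹_{t,x}` (`PassiveScalarCommutatorSobolev` through the
translation estimate `‖u(· + z) - u‖_{L²} ≤ |z| ‖∇u‖_{L²}`, `TorusTranslationEstimate`). Hence
`2κ ∫₀ᵀ ‖∇(S_M ∘ A_ε)‖² ≤ ‖θ₀‖₂² + C_M ‖r_ε‖_{L¹}`, and two lower-semicontinuity/Fatou passages
(`ε → 0`, then `M → ∞`) conclude.

## References

* C. Seis, *Bounds on the rate of enhanced dissipation*, Comm. Math. Phys. 2022
  (arXiv:2003.08794), Thm. 2 and its proof, p. 8. [`Seis2022`]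
* R. J. DiPerna, P.-L. Lions, Invent. Math. 98 (1989), §II.3, Thm. II.3. [`DiPernaLions1989`]
* P. Bonicatto, G. Ciampa, G. Crippa, J. Evol. Equ. 24 (2024), Thm. 3.3.
  [`BonicattoCiampaCrippa2023`]
-/

noncomputable section

open MeasureTheory TopologicalSpace Set Function Filter Topology Metric ContinuousLinearMap
  UnitAddTorus
open scoped ENNReal NNReal Convolution ContDiff InnerProductSpace

namespace Literature.Analysis.FluidPDE

namespace Torus

variable {d : Type*} [Fintype d]

namespace IsWeakScalarTransportOn

variable {T κ : ℝ} {u : ℝ → UnitAddTorus d → EuclideanSpace ℝ d} {θ₀ : UnitAddTorus d → ℝ}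
  {θ : ℝ → UnitAddTorus d → ℝ}

/-! ## Slices of the velocity -/

/-- For a.e. `t ∈ (0,T)` the velocity slice is in `L²` (`u ∈ L¹(0,T; L²(T^d))`). [folklore] -/
theorem ae_memLp_two_velocity (h : IsWeakScalarTransportOn T κ u θ₀ θ) :
    ∀ᵐ t ∂((volume : Measure ℝ).restrict (Ioo 0 T)), MemLp (u t) 2 volume := by
  have hm : AEMeasurable (fun t => (∫⁻ x, ‖u t x‖ₑ ^ 2) ^ (1 / 2 : ℝ))
      ((volume : Measure ℝ).restrict (Ioo 0 T)) :=
    ((h.aestronglyMeasurable_uncurry_velocity.enorm.pow_const 2).lintegral_prod_right').pow_const _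
  filter_upwards [ae_lt_top' hm h.lintegral_velocity_lt_top.ne, h.ae_aestronglyMeasurable_velocity_slice]
    with t ht hmt
  have h2 : ∫⁻ x, ‖u t x‖ₑ ^ 2 < ⊤ := by
    by_contra hc
    rw [not_lt, top_le_iff] at hc
    rw [hc, ENNReal.top_rpow_of_pos (by norm_num)] at ht
    exact lt_irrefl _ ht
  refine ⟨hmt, ?_⟩
  rw [eLpNorm_eq_lintegral_rpow_enorm_toReal two_ne_zero ENNReal.ofNat_ne_top, ENNReal.toReal_ofNat]
  have e : ∫⁻ x, ‖u t x‖ₑ ^ (2 : ℝ) = ∫⁻ x, ‖u t x‖ₑ ^ 2 := lintegral_congr fun x => by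
    rw [ENNReal.rpow_two]
  rw [e]
  exact ENNReal.rpow_lt_top_of_nonneg (by norm_num) h2.ne

/-! ## Joint measurability and Fubini for `w(A) · G` -/

/-- Joint measurability of the commutator `r(s, x)` of a single solution. [folklore] -/
theorem aestronglyMeasurable_uncurry_comm₁ (h : IsWeakScalarTransportOn T κ u θ₀ θ)
    {k : UnitAddTorus d → ℝ} (hk : FunctionSpaces.Torus.IsSmooth k) :
    AEStronglyMeasurable (uncurry fun s x => ∫ y, θ s y *
      ⟪u s x - u s y, FunctionSpaces.Torus.gradient k (x - y)⟫_ℝ)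
      (((volume : Measure ℝ).restrict (Ioo 0 T)).prod volume) := by
  set Ψ : (ℝ × UnitAddTorus d) × UnitAddTorus d → ℝ := fun q => θ q.1.1 q.2 *
    ⟪u q.1.1 q.1.2 - u q.1.1 q.2, FunctionSpaces.Torus.gradient k (q.1.2 - q.2)⟫_ℝ with hΨ
  have hsub : AEStronglyMeasurable (fun q : (ℝ × UnitAddTorus d) × UnitAddTorus d => q.1.2 - q.2)
      ((((volume : Measure ℝ).restrict (Ioo 0 T)).prod volume).prod volume) :=
    (measurable_fst.snd.sub measurable_snd).aestronglyMeasurable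
  have hΨm : AEStronglyMeasurable Ψ ((((volume : Measure ℝ).restrict (Ioo 0 T)).prod volume).prod volume) := by
    refine (FunctionSpaces.Torus.aestronglyMeasurable_comp_fst_snd h.aestronglyMeasurable_uncurry).mul ?_
    exact ((FunctionSpaces.Torus.aestronglyMeasurable_comp_fst h.aestronglyMeasurable_uncurry_velocity).sub
      (FunctionSpaces.Torus.aestronglyMeasurable_comp_fst_snd h.aestronglyMeasurable_uncurry_velocity)).inner
      (hk.gradient.continuous.comp_aestronglyMeasurable hsub)
  have e : (uncurry fun s x => ∫ y, θ s y * ⟪u s x - u s y, FunctionSpaces.Torus.gradient k (x - y)⟫_ℝ) =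
      fun p => ∫ y, Ψ (p, y) := by
    funext p
    rfl
  rw [e]
  exact hΨm.integral_prod_right'

/-- **Integrability of `w(A) · G` on `(0,T) × T^d`** for a continuous bounded weight `w`
(`|G(s,x)| ≤ bound(s) ∈ L¹`). [folklore] -/
theorem integrable_comp_molInt_mul_flux (h : IsWeakScalarTransportOn T κ u θ₀ θ) {k : UnitAddTorus d → ℝ}
    (hk : FunctionSpaces.Torus.IsSmooth k) {w : ℝ → ℝ} (hw : Continuous w) {Cw : ℝ} (hCw : ∀ a, |w a| ≤ Cw) :
    Integrable (fun p : ℝ × UnitAddTorus d => w (∫ y, θ p.1 y * k (p.2 - y)) *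
      ∫ y, θ p.1 y * (-⟪u p.1 y, FunctionSpaces.Torus.gradient k (p.2 - y)⟫_ℝ + κ * FunctionSpaces.Torus.laplacian k (p.2 - y)))
      (((volume : Measure ℝ).restrict (Ioo 0 T)).prod volume) := by
  set μT : Measure ℝ := (volume : Measure ℝ).restrict (Ioo 0 T) with hμT
  obtain ⟨bound, hbi, hGb⟩ := h.exists_flux_bound₁ hk
  have hCw0 : 0 ≤ Cw := (abs_nonneg _).trans (hCw 0)
  have hFm : AEStronglyMeasurable (fun p : ℝ × UnitAddTorus d => w (∫ y, θ p.1 y * k (p.2 - y)) *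
      ∫ y, θ p.1 y * (-⟪u p.1 y, FunctionSpaces.Torus.gradient k (p.2 - y)⟫_ℝ + κ * FunctionSpaces.Torus.laplacian k (p.2 - y)))
      (μT.prod volume) :=
    (hw.comp_aestronglyMeasurable (h.aestronglyMeasurable_uncurry_molInt₁ hk.continuous)).mul
      (h.aestronglyMeasurable_uncurry_flux₁ hk)
  have hBi : Integrable (fun p : ℝ × UnitAddTorus d => Cw * bound p.1 * (1 : ℝ)) (μT.prod volume) :=
    ((hbi.const_mul Cw).mul_prod (integrable_const (1 : ℝ)))
  refine Integrable.mono' (hBi.congr (Eventually.of_forall fun p => mul_one _)) hFm ?_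
  have hae : ∀ᵐ s ∂μT, ∀ x, ‖w (∫ y, θ s y * k (x - y)) *
      ∫ y, θ s y * (-⟪u s y, FunctionSpaces.Torus.gradient k (x - y)⟫_ℝ + κ * FunctionSpaces.Torus.laplacian k (x - y))‖ ≤
        Cw * bound s := by
    filter_upwards [hGb] with s hG x
    rw [norm_mul, Real.norm_eq_abs]
    exact mul_le_mul (hCw _) (hG x) (norm_nonneg _) hCw0
  have := (Measure.quasiMeasurePreserving_fst (μ := μT) (ν := (volume : Measure (UnitAddTorus d)))).ae hae
  filter_upwards [this] with p hp
  exact hp p.2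

/-- **Fubini for `w(A) · G` on `(0, t] × T^d`**, `t < T`. [folklore] -/
theorem integral_integral_comp_molInt_mul_flux_swap (h : IsWeakScalarTransportOn T κ u θ₀ θ)
    {k : UnitAddTorus d → ℝ} (hk : FunctionSpaces.Torus.IsSmooth k) {w : ℝ → ℝ} (hw : Continuous w) {Cw : ℝ}
    (hCw : ∀ a, |w a| ≤ Cw) {t : ℝ} (ht : t ∈ Ioo 0 T) :
    ∫ x, ∫ s in Ioc 0 t, w (∫ y, θ s y * k (x - y)) *
        ∫ y, θ s y * (-⟪u s y, FunctionSpaces.Torus.gradient k (x - y)⟫_ℝ + κ * FunctionSpaces.Torus.laplacian k (x - y)) =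
      ∫ s in Ioc 0 t, ∫ x, w (∫ y, θ s y * k (x - y)) *
        ∫ y, θ s y * (-⟪u s y, FunctionSpaces.Torus.gradient k (x - y)⟫_ℝ + κ * FunctionSpaces.Torus.laplacian k (x - y)) := by
  have hsub : Ioc 0 t ⊆ Ioo 0 T := Ioc_subset_Ioo_right ht.2
  have hle : (volume : Measure ℝ).restrict (Ioc 0 t) ≤ (volume : Measure ℝ).restrict (Ioo 0 T) :=
    Measure.restrict_mono_set _ hsub
  have hFi := (h.integrable_comp_molInt_mul_flux hk hw hCw).mono_measure (Measure.prod_mono hle le_rfl)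
  exact integral_integral_swap (μ := (volume : Measure (UnitAddTorus d)))
    (ν := (volume : Measure ℝ).restrict (Ioc 0 t))
    (f := fun x s => w (∫ y, θ s y * k (x - y)) *
      ∫ y, θ s y * (-⟪u s y, FunctionSpaces.Torus.gradient k (x - y)⟫_ℝ + κ * FunctionSpaces.Torus.laplacian k (x - y))) hFi.swap

/-! ## The renormalised mollified identity, a.e. in time -/

/-- **The renormalised mollified identity with datum** (DiPerna–Lions 1989, §II.3, integrated
form, a.e. in time): for `θ₀ ∈ L¹`, a smooth kernel `k`, `A(t) = θ(t) ⋆ k`, the flux `G` and a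
globally Lipschitz `C¹` function `β`, for a.e. `t ∈ (0,T)`:
`∫ β(A(t,x)) dx = ∫ β((θ₀ ⋆ k)(x)) dx + ∫_{(0,t]} ∫ β'(A(s,x)) G(s,x) dx ds`. [cite: DiPernaLions1989, §II.3] -/
theorem ae_integral_comp_molInt_eq (h : IsWeakScalarTransportOn T κ u θ₀ θ)
    (hθ₀ : Integrable θ₀ volume) {k : UnitAddTorus d → ℝ} (hk : FunctionSpaces.Torus.IsSmooth k)
    {β : ℝ → ℝ} (hβ : ContDiff ℝ 1 β) {K : NNReal} (hβK : LipschitzWith K β) :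
    ∀ᵐ t ∂(volume.restrict (Ioo 0 T)),
      ∫ x, β (∫ y, θ t y * k (x - y)) = (∫ x, β (∫ y, θ₀ y * k (x - y))) +
        ∫ s in Ioc 0 t, ∫ x, deriv β (∫ y, θ s y * k (x - y)) *
          ∫ y, θ s y * (-⟪u s y, FunctionSpaces.Torus.gradient k (x - y)⟫_ℝ + κ * FunctionSpaces.Torus.laplacian k (x - y)) := by
  -- the weight `β'` is continuous and bounded by `K`
  have hβ'c : Continuous (deriv β) := hβ.continuous_deriv le_rfl
  have hβ'b : ∀ a, |deriv β a| ≤ K := fun a => by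
    rw [← Real.norm_eq_abs]; exact norm_deriv_le_of_lipschitz hβK
  filter_upwards [h.ae_forall_molInt_eq_datum_add_setIntegral_flux hθ₀ hk,
    ae_restrict_mem measurableSet_Ioo, h.ae_slice_integrable₁] with t hAt htT hst
  have hsub : Ioc 0 t ⊆ Ioo 0 T := Ioc_subset_Ioo_right htT.2
  -- Step 1: pointwise in `x`
  have hpt : ∀ x, β (∫ y, θ t y * k (x - y)) = β (∫ y, θ₀ y * k (x - y)) +
      ∫ s in Ioc 0 t, deriv β (∫ y, θ s y * k (x - y)) *
        ∫ y, θ s y * (-⟪u s y, FunctionSpaces.Torus.gradient k (x - y)⟫_ℝ + κ * FunctionSpaces.Torus.laplacian k (x - y)) := by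
    intro x
    have hGx : IntegrableOn (fun s => ∫ y, θ s y *
        (-⟪u s y, FunctionSpaces.Torus.gradient k (x - y)⟫_ℝ + κ * FunctionSpaces.Torus.laplacian k (x - y))) (Ioo 0 T) volume :=
      (h.integrable_mul_flux hk x).integral_prod_left
    rw [hAt x, Calculus.comp_const_add_setIntegral_eq htT.1.le (hGx.mono_set hsub) hβ hβK]
    congr 1
    refine integral_congr_ae ?_
    filter_upwards [ae_restrict_of_ae_restrict_of_subset hsub
      (h.ae_molInt_eq_datum_add_setIntegral_flux hk x)] with s hs
    rw [hs]
  -- Step 2: integrate in `x` and swap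
  have hconv : ∀ {δ : UnitAddTorus d → ℝ}, Integrable δ volume → Continuous fun x => ∫ y, δ y * k (x - y) := by
    intro δ hδ
    have e : (fun x => ∫ y, δ y * k (x - y)) = δ ⋆ k := by
      funext x; simp only [convolution_lsmul, smul_eq_mul]
    rw [e]
    exact FunctionSpaces.Torus.continuous_convolution hδ hk.continuous
  have i0 : Integrable (fun x => β (∫ y, θ₀ y * k (x - y))) volume :=
    (hβ.continuous.comp (hconv hθ₀)).integrable_unitAddTorus
  have hI : Integrable (fun x => ∫ s in Ioc 0 t, deriv β (∫ y, θ s y * k (x - y)) *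
      ∫ y, θ s y * (-⟪u s y, FunctionSpaces.Torus.gradient k (x - y)⟫_ℝ + κ * FunctionSpaces.Torus.laplacian k (x - y))) volume := by
    have hle : (volume : Measure ℝ).restrict (Ioc 0 t) ≤ (volume : Measure ℝ).restrict (Ioo 0 T) :=
      Measure.restrict_mono_set _ hsub
    have hFi := (h.integrable_comp_molInt_mul_flux hk hβ'c hβ'b).mono_measure (Measure.prod_mono hle le_rfl)
    exact hFi.swap.integral_prod_left
  simp_rw [hpt]
  rw [integral_add i0 hI, h.integral_integral_comp_molInt_mul_flux_swap hk hβ'c hβ'b htT]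

/-! ## Measurability of the renormalised dissipation and of the commutator size -/

/-- `s ↦ ∫ w(A(s,x)) ‖(θ(s) ⋆ ∇k)(x)‖² dx` is a.e.-strongly measurable on `(0,T)` for a
continuous weight `w`. [folklore] -/
theorem aestronglyMeasurable_integral_comp_mul_norm_sq (h : IsWeakScalarTransportOn T κ u θ₀ θ)
    {k : UnitAddTorus d → ℝ} (hk : FunctionSpaces.Torus.IsSmooth k) {w : ℝ → ℝ} (hw : Continuous w) :
    AEStronglyMeasurable (fun s => ∫ x, w (∫ y, θ s y * k (x - y)) *
      ‖(θ s ⋆ FunctionSpaces.Torus.gradient k) x‖ ^ 2) ((volume : Measure ℝ).restrict (Ioo 0 T)) := by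
  have hm : AEStronglyMeasurable (uncurry fun s x => w (∫ y, θ s y * k (x - y)) *
      ‖(θ s ⋆ FunctionSpaces.Torus.gradient k) x‖ ^ 2) (((volume : Measure ℝ).restrict (Ioo 0 T)).prod volume) :=
    (hw.comp_aestronglyMeasurable (h.aestronglyMeasurable_uncurry_molInt₁ hk.continuous)).mul
      ((continuous_pow 2).comp_aestronglyMeasurable
        (FunctionSpaces.Torus.aestronglyMeasurable_uncurry_convolution (lsmul ℝ ℝ) h.aestronglyMeasurable_uncurry
          hk.gradient.continuous).norm)
  exact hm.integral_prod_right'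

/-- `s ↦ ∫⁻ |r(s, x)| dx` is a.e.-measurable on `(0,T)`. [folklore] -/
theorem aemeasurable_lintegral_enorm_comm (h : IsWeakScalarTransportOn T κ u θ₀ θ)
    {k : UnitAddTorus d → ℝ} (hk : FunctionSpaces.Torus.IsSmooth k) :
    AEMeasurable (fun s => ∫⁻ x, ‖∫ y, θ s y * ⟪u s x - u s y, FunctionSpaces.Torus.gradient k (x - y)⟫_ℝ‖ₑ)
      ((volume : Measure ℝ).restrict (Ioo 0 T)) :=
  (h.aestronglyMeasurable_uncurry_comm₁ hk).enorm.lintegral_prod_right'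

/-! ## The commutator size: bound and convergence along the slices -/

/-- The translation modulus of an `Ḣ¹` slice at scale `ε`: where `∇k_ε(z) ≠ 0`,
`‖v(· + z) - v‖_{L²} ≤ ε ‖∇v‖_{L²}`. [folklore] -/
theorem eLpNorm_sub_translate_le_of_gradient_kernel_ne_zero {v : UnitAddTorus d → EuclideanSpace ℝ d}
    (hv : MemLp v 2 volume) {ε : ℝ} (hε : 0 < ε) (hε' : ε ≤ 1 / 4) {z : UnitAddTorus d}
    (hz : FunctionSpaces.Torus.gradient (FunctionSpaces.Torus.kernel ε) z ≠ 0) :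
    eLpNorm (fun y => v (y + z) - v y) 2 volume ≤
      ENNReal.ofReal ε * FunctionSpaces.Torus.eGradNormSq v ^ (1 / 2 : ℝ) := by
  have h1 := FunctionSpaces.Torus.eLpNorm_sub_translate_le hv (FunctionSpaces.Torus.reprc z)
  rw [FunctionSpaces.Torus.proj_reprc] at h1
  refine h1.trans (mul_le_mul' (ENNReal.ofReal_le_ofReal
    (norm_reprc_le_of_gradient_kernel_ne_zero hε hε' hz)) le_rfl)

/-- **The `L¹` size of the commutator of an `L²` slice against an `Ḣ¹` drift**:
`∫ |r_ε[δ]| ≤ ‖δ‖_{L²} ‖∇v‖_{L²} C₁`, uniformly in `ε` (the `L¹` commutator bound through the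
translation modulus `ε ‖∇v‖_{L²}`). [folklore] -/
theorem lintegral_enorm_comm_le_eGradNormSq {δ : UnitAddTorus d → ℝ} {v : UnitAddTorus d → EuclideanSpace ℝ d}
    (hδ : MemLp δ 2 volume) (hv : MemLp v 2 volume) {ε : ℝ} (hε : 0 < ε) (hε' : ε ≤ 1 / 4) :
    ∫⁻ x, ‖∫ y, δ y * ⟪v x - v y,
        FunctionSpaces.Torus.gradient (FunctionSpaces.Torus.kernel ε) (x - y)⟫_ℝ‖ₑ ≤
      eLpNorm δ 2 volume * FunctionSpaces.Torus.eGradNormSq v ^ (1 / 2 : ℝ) *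
        ENNReal.ofReal (FunctionSpaces.Torus.gradProfileMass d) := by
  have h1 := lintegral_enorm_comm_le_of_translate hδ hv.1 hε hε'
    (A := ENNReal.ofReal ε * FunctionSpaces.Torus.eGradNormSq v ^ (1 / 2 : ℝ))
    fun z hz => eLpNorm_sub_translate_le_of_gradient_kernel_ne_zero hv hε hε' hz
  refine h1.trans (le_of_eq ?_)
  rw [ENNReal.ofReal_mul (inv_nonneg.2 hε.le), ENNReal.ofReal_inv_of_pos hε]
  have hε0 : ENNReal.ofReal ε ≠ 0 := (ENNReal.ofReal_pos.2 hε).ne'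
  calc eLpNorm δ 2 volume * (ENNReal.ofReal ε * FunctionSpaces.Torus.eGradNormSq v ^ (1 / 2 : ℝ)) *
        ((ENNReal.ofReal ε)⁻¹ * ENNReal.ofReal (FunctionSpaces.Torus.gradProfileMass d))
      = eLpNorm δ 2 volume * FunctionSpaces.Torus.eGradNormSq v ^ (1 / 2 : ℝ) *
          ENNReal.ofReal (FunctionSpaces.Torus.gradProfileMass d) * (ENNReal.ofReal ε * (ENNReal.ofReal ε)⁻¹) := by ring
    _ = _ := by rw [ENNReal.mul_inv_cancel hε0 ENNReal.ofReal_ne_top, mul_one]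

/-! ## Truncation in `L²` -/

/-- Truncation is `1`-Lipschitz in `L²`: `‖S_M ∘ f - S_M ∘ g‖_{L²} ≤ ‖f - g‖_{L²}`. [folklore] -/
theorem eLpNorm_trunc_comp_sub_le (M : ℝ) (f g : UnitAddTorus d → ℝ) :
    eLpNorm (fun x => Calculus.trunc M (f x) - Calculus.trunc M (g x)) 2 volume ≤ eLpNorm (f - g) 2 volume :=
  eLpNorm_mono fun x => by
    rw [Real.norm_eq_abs, Pi.sub_apply, Real.norm_eq_abs]
    exact Calculus.abs_trunc_sub_trunc_le M (f x) (g x)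

/-- **Removing the truncation in `L²`**: `‖S_M ∘ f - f‖_{L²} → 0` as `M → ∞` for `f ∈ L²`
(dominated convergence, `|S_M(a) - a| ≤ 2|a|`). [folklore] -/
theorem tendsto_eLpNorm_trunc_comp_sub {f : UnitAddTorus d → ℝ} (hf : MemLp f 2 volume) :
    Tendsto (fun M : ℕ => eLpNorm (fun x => Calculus.trunc M (f x) - f x) 2 volume) atTop (𝓝 0) := by
  have hlin : Tendsto (fun M : ℕ => ∫⁻ x, ‖Calculus.trunc M (f x) - f x‖ₑ ^ (2 : ℝ)) atTop (𝓝 0) := by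
    have hb : ∫⁻ x, (2 * ‖f x‖ₑ) ^ (2 : ℝ) ≠ ⊤ := by
      have e : ∫⁻ x, (2 * ‖f x‖ₑ) ^ (2 : ℝ) = 2 ^ (2 : ℝ) * ∫⁻ x, ‖f x‖ₑ ^ (2 : ℝ) := by
        rw [← lintegral_const_mul' _ _ (ENNReal.rpow_ne_top_of_nonneg (by norm_num) ENNReal.ofNat_ne_top)]
        exact lintegral_congr fun x => by rw [ENNReal.mul_rpow_of_nonneg _ _ (by norm_num)]
      rw [e]
      refine ENNReal.mul_ne_top (ENNReal.rpow_ne_top_of_nonneg (by norm_num) ENNReal.ofNat_ne_top) ?_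
      have := hf.eLpNorm_lt_top
      rw [eLpNorm_eq_lintegral_rpow_enorm_toReal two_ne_zero ENNReal.ofNat_ne_top, ENNReal.toReal_ofNat] at this
      exact (ENNReal.rpow_lt_top_iff_of_pos (by norm_num : (0 : ℝ) < 1 / 2)).1 this |>.ne
    have hmeas : ∀ M : ℕ, AEMeasurable (fun x => ‖Calculus.trunc M (f x) - f x‖ₑ ^ (2 : ℝ)) volume := fun M =>
      ((((Calculus.contDiff_trunc (M : ℝ)).continuous.comp_aestronglyMeasurable hf.1).sub hf.1).enorm.pow_const _)
    have hdom : ∀ M : ℕ, ∀ᵐ x ∂(volume : Measure (UnitAddTorus d)),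
        ‖Calculus.trunc M (f x) - f x‖ₑ ^ (2 : ℝ) ≤ (2 * ‖f x‖ₑ) ^ (2 : ℝ) := by
      intro M
      refine Eventually.of_forall fun x => ENNReal.rpow_le_rpow ?_ (by norm_num)
      rw [Real.enorm_eq_ofReal_abs, ← ofReal_norm, Real.norm_eq_abs, ← ENNReal.ofReal_ofNat,
        ← ENNReal.ofReal_mul zero_le_two]
      refine ENNReal.ofReal_le_ofReal ?_
      calc |Calculus.trunc M (f x) - f x| ≤ |Calculus.trunc M (f x)| + |f x| := abs_sub _ _
        _ ≤ |f x| + |f x| := add_le_add (Calculus.abs_trunc_le _ _) le_rfl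
        _ = 2 * |f x| := by ring
    have hpt : ∀ᵐ x ∂(volume : Measure (UnitAddTorus d)),
        Tendsto (fun M : ℕ => ‖Calculus.trunc M (f x) - f x‖ₑ ^ (2 : ℝ)) atTop (𝓝 ((fun _ => (0 : ℝ≥0∞)) x)) := by
      refine Eventually.of_forall fun x => ?_
      have h1 : Tendsto (fun M : ℕ => Calculus.trunc M (f x) - f x) atTop (𝓝 0) := by
        have := ((Calculus.tendsto_trunc_atTop (f x)).comp tendsto_natCast_atTop_atTop).sub_const (f x)
        rwa [sub_self] at this
      have h2 : Tendsto (fun M : ℕ => ‖Calculus.trunc M (f x) - f x‖ₑ) atTop (𝓝 0) := by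
        rw [← enorm_zero (E := ℝ)]
        exact h1.enorm
      have h3 := h2.ennrpow_const (2 : ℝ)
      rwa [ENNReal.zero_rpow_of_pos (by norm_num)] at h3
    have := tendsto_lintegral_of_dominated_convergence' _ hmeas hdom hb hpt
    simpa using this
  have h := hlin.ennrpow_const (1 / 2 : ℝ)
  rw [ENNReal.zero_rpow_of_pos (by norm_num)] at h
  refine h.congr fun M => ?_
  rw [eLpNorm_eq_lintegral_rpow_enorm_toReal two_ne_zero ENNReal.ofNat_ne_top, ENNReal.toReal_ofNat]

/-- `liminf` of a sequence of a.e.-measurable `ℝ≥0∞`-valued functions is a.e.-measurable. [folklore] -/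
theorem _root_.Literature.Analysis.FluidPDE.aemeasurable_liminf_nat {α : Type*} [MeasurableSpace α]
    {μ : Measure α} {f : ℕ → α → ℝ≥0∞} (hf : ∀ n, AEMeasurable (f n) μ) :
    AEMeasurable (fun x => liminf (fun n => f n x) atTop) μ := by
  refine ⟨fun x => liminf (fun n => (hf n).mk (f n) x) atTop, Measurable.liminf fun n => (hf n).measurable_mk, ?_⟩
  filter_upwards [ae_all_iff.2 fun n => (hf n).ae_eq_mk] with x hx
  show liminf (fun n => f n x) atTop = liminf (fun n => (hf n).mk (f n) x) atTop
  congr 1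
  funext n
  exact hx n

/-! ## The renormalised dissipation of a slice -/

/-- **The renormalised dissipation of a smooth slice is the dissipation of its truncation**:
`ofReal (κ ∫ β_M''(A) ‖∇A‖²) = 2κ · eScalarGradNormSq (S_M ∘ A)` (`β_M'' = 2 (S_M')²`,
`∇(S_M ∘ A) = S_M'(A) ∇A`). [folklore] -/
theorem ofReal_mul_integral_renorm_dissipation {A : UnitAddTorus d → ℝ} (hA : FunctionSpaces.Torus.IsSmooth A)
    (M : ℝ) {κ : ℝ} (hκ : 0 ≤ κ) :
    ENNReal.ofReal (κ * ∫ x, deriv (Calculus.renormDeriv M) (A x) * ‖FunctionSpaces.Torus.gradient A x‖ ^ 2) =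
      ENNReal.ofReal (2 * κ) * eScalarGradNormSq (Calculus.trunc M ∘ A) := by
  have hA1 : FunctionSpaces.Torus.IsContDiff 1 A := hA.isContDiff (by simp)
  have hS : FunctionSpaces.Torus.IsSmooth (Calculus.trunc M ∘ A) := hA.comp_left (Calculus.contDiff_trunc M)
  have hS1 : ContDiff ℝ 1 (Calculus.trunc M) := (Calculus.contDiff_trunc M).of_le (by simp)
  rw [eScalarGradNormSq_eq_ofReal_integral hS, ← ENNReal.ofReal_mul (by positivity)]
  congr 1
  have hpt : ∀ x, deriv (Calculus.renormDeriv M) (A x) * ‖FunctionSpaces.Torus.gradient A x‖ ^ 2 =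
      2 * ‖FunctionSpaces.Torus.gradient (Calculus.trunc M ∘ A) x‖ ^ 2 := by
    intro x
    rw [gradient_comp_left hS1 hA1, norm_smul, mul_pow, Calculus.deriv_renormDeriv_eq, Real.norm_eq_abs, sq_abs]
    ring
  simp_rw [hpt]
  rw [MeasureTheory.integral_const_mul]
  ring

/-- `|∫ w(x) r(x) dx| ≤ C (∫⁻ |r|).toReal` for a weight `|w| ≤ C` and `r` of finite `L¹` size. [folklore] -/
theorem abs_integral_mul_le_mul_toReal_lintegral {w r : UnitAddTorus d → ℝ} {C : ℝ} (hC : ∀ x, |w x| ≤ C)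
    (hr : AEStronglyMeasurable r volume) (hfin : ∫⁻ x, ‖r x‖ₑ < ⊤) :
    |∫ x, w x * r x| ≤ C * (∫⁻ x, ‖r x‖ₑ).toReal := by
  have hC0 : 0 ≤ C := (abs_nonneg _).trans (hC 0)
  have hri : Integrable r volume := ⟨hr, hfin⟩
  rw [← integral_norm_eq_lintegral_enorm hr, ← MeasureTheory.integral_const_mul, ← Real.norm_eq_abs]
  refine norm_integral_le_of_norm_le (hri.norm.const_mul C) (Eventually.of_forall fun x => ?_)
  rw [norm_mul, Real.norm_eq_abs, Real.norm_eq_abs]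
  exact mul_le_mul_of_nonneg_right (hC x) (abs_nonneg _)

/-! ## The energy inequality for `L² ∩ Ḣ¹` drifts -/

/-- **Energy inequality for weak solutions of the passive scalar equation with `L² ∩ Ḣ¹` drift**
(the inequality `κ ∫₀ᵗ ‖∇θ‖²_{L²} ≤ ∫ θ₀²` used in the proof of Seis 2022, Thm. 2, p. 8, here as
`2κ ∫₀ᵀ ‖∇θ‖² ≤ ‖θ₀‖²_{L²}`; DiPerna–Lions 1989, §II.3 renormalisation for `W^{1,1}` drifts with
the `L²`/`L²` integrability pairing): for `κ > 0`, `θ₀ ∈ L²`, a weak solution `θ ∈ L^∞(0,T;L²)`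
whose drift has `‖∇u(t)‖²_{L²} ≤ G` for a.e. `t`,
`2 · eScalarDissipation κ θ 0 T ≤ ∫ ‖θ₀‖ₑ²`. [cite: Seis2022, proof of Thm. 2 (p. 8)] -/
theorem energy_ineq_of_eGradNormSq_le (hκ : 0 < κ) (h : IsWeakScalarTransportOn T κ u θ₀ θ)
    (hθ₀ : MemLp θ₀ 2 volume) {G : ℝ≥0}
    (hG : ∀ᵐ t ∂(volume.restrict (Ioo 0 T)), FunctionSpaces.Torus.eGradNormSq (u t) ≤ G) :
    2 * eScalarDissipation κ θ 0 T ≤ ∫⁻ x, ‖θ₀ x‖ₑ ^ 2 := by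
  classical
  -- trivial case `T ≤ 0`
  rcases le_or_gt T 0 with hT | hT
  · have h0 : eScalarDissipation κ θ 0 T = 0 := by
      rw [eScalarDissipation, Ioo_eq_empty_of_le hT, Measure.restrict_empty, lintegral_zero_measure,
        mul_zero]
    rw [h0, mul_zero]
    exact zero_le
  set μT : Measure ℝ := (volume : Measure ℝ).restrict (Ioo 0 T) with hμT
  haveI : IsFiniteMeasure μT := by rw [hμT]; infer_instance
  -- radii and kernels
  obtain ⟨hε, hε', hε0⟩ := molRadius_spec
  set ε : ℕ → ℝ := fun n => 1 / (4 * ((n : ℝ) + 1)) with hε_def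
  set kk : ℕ → UnitAddTorus d → ℝ := fun n => FunctionSpaces.Torus.kernel (d := d) (ε n) with hkk
  have hkS : ∀ n, FunctionSpaces.Torus.IsSmooth (kk n) := fun n => FunctionSpaces.Torus.isSmooth_kernel (hε n) (hε' n)
  have hk1 : ∀ n, ∫⁻ y, ‖kk n y‖ₑ = 1 := fun n => FunctionSpaces.Torus.lintegral_enorm_kernel (hε n) (hε' n)
  -- bounds on the slices
  obtain ⟨C₁, hC₁⟩ := h.exists_eLpNorm_le
  have hθ₀i : Integrable θ₀ volume := hθ₀.integrable one_le_two
  have hgood : ∀ᵐ s ∂μT, (Integrable (θ s) volume ∧ AEStronglyMeasurable (u s) volume ∧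
      Integrable (fun y => ‖u s y‖ * θ s y) volume) ∧ FunctionSpaces.Torus.IsWeaklyDivFree (u s) ∧
      MemLp (θ s) 2 volume ∧ eLpNorm (θ s) 2 volume ≤ C₁ ∧ Integrable (u s) volume ∧ MemLp (u s) 2 volume ∧
      FunctionSpaces.Torus.eGradNormSq (u s) ≤ G := by
    filter_upwards [h.ae_slice_integrable₁, h.ae_isWeaklyDivFree, h.ae_memLp_two, hC₁, h.ae_integrable_velocity,
      h.ae_memLp_two_velocity, hG] with s h1 h2 h3 h4 h5 h6 h7
    exact ⟨h1, h2, h3, h4, h5, h6, h7⟩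
  -- conversions between the integral and the convolution forms
  have hconv : ∀ (δ : UnitAddTorus d → ℝ) (n : ℕ) (x : UnitAddTorus d), (δ ⋆ kk n) x = ∫ y, δ y * kk n (x - y) :=
    fun δ n x => by simp only [convolution_lsmul, smul_eq_mul]
  -- ### the commutator size `ρ n s = ∫ |r_n(s,x)| dx`
  set ρ : ℕ → ℝ → ℝ≥0∞ := fun n s => ∫⁻ x, ‖∫ y, θ s y * ⟪u s x - u s y,
    FunctionSpaces.Torus.gradient (kk n) (x - y)⟫_ℝ‖ₑ with hρ_def
  have hρm : ∀ n, AEMeasurable (ρ n) μT := fun n => h.aemeasurable_lintegral_enorm_comm (hkS n)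
  set Kρ : ℝ≥0∞ := (C₁ : ℝ≥0∞) * (G : ℝ≥0∞) ^ (1 / 2 : ℝ) * ENNReal.ofReal (FunctionSpaces.Torus.gradProfileMass d) with hKρ
  have hKρt : Kρ ≠ ⊤ := ENNReal.mul_ne_top (ENNReal.mul_ne_top ENNReal.coe_ne_top
    (ENNReal.rpow_ne_top_of_nonneg (by norm_num) ENNReal.coe_ne_top)) ENNReal.ofReal_ne_top
  have hρle : ∀ n, ∀ᵐ s ∂μT, ρ n s ≤ Kρ := by
    intro n
    filter_upwards [hgood] with s hs
    obtain ⟨-, -, hθ2, hθC, -, hu2, huG⟩ := hs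
    refine (lintegral_enorm_comm_le_eGradNormSq hθ2 hu2 (hε n) (hε' n)).trans ?_
    rw [hKρ]
    gcongr
  have hρ0 : ∀ᵐ s ∂μT, Tendsto (fun n => ρ n s) atTop (𝓝 0) := by
    filter_upwards [hgood] with s hs
    obtain ⟨⟨-, -, huθ⟩, hdiv, hθ2, -, hui, hu2, huG⟩ := hs
    refine tendsto_lintegral_enorm_comm hθ2 hui huθ hdiv (B := (G : ℝ≥0∞) ^ (1 / 2 : ℝ))
      (ENNReal.rpow_ne_top_of_nonneg (by norm_num) ENNReal.coe_ne_top) hε hε' hε0 fun n z hz => ?_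
    refine (eLpNorm_sub_translate_le_of_gradient_kernel_ne_zero hu2 (hε n) (hε' n) hz).trans ?_
    gcongr
  have hP0 : Tendsto (fun n => ∫⁻ s, ρ n s ∂μT) atTop (𝓝 0) := by
    have hb : ∫⁻ _ : ℝ, Kρ ∂μT ≠ ⊤ := by
      rw [lintegral_const]; exact ENNReal.mul_ne_top hKρt (measure_ne_top _ _)
    have := tendsto_lintegral_of_dominated_convergence' (fun _ => Kρ) hρm hρle hb
      (hρ0.mono fun s hs => by simpa using hs)
    simpa using this
  have hPt : ∀ n, ∫⁻ s, ρ n s ∂μT ≠ ⊤ := fun n =>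
    ne_top_of_le_ne_top (by rw [lintegral_const]; exact ENNReal.mul_ne_top hKρt (measure_ne_top _ _))
      (lintegral_mono_ae (hρle n))
  -- ### the datum term
  set a : ℝ≥0∞ := ∫⁻ x, ‖θ₀ x‖ₑ ^ 2 with ha_def
  have hat : a ≠ ⊤ := by
    rw [ha_def, ← PassiveScalarProofs.eLpNorm_two_pow_two]
    exact ENNReal.pow_ne_top hθ₀.eLpNorm_ne_top
  have ha0 : ∀ n, ENNReal.ofReal (∫ x, (θ₀ ⋆ kk n) x ^ 2) ≤ a := by
    intro n
    have hc : Continuous (θ₀ ⋆ kk n) := FunctionSpaces.Torus.continuous_convolution hθ₀i (hkS n).continuous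
    rw [← lintegral_enorm_sq_eq_ofReal_integral_sq hc, ← PassiveScalarProofs.eLpNorm_two_pow_two, ha_def,
      ← PassiveScalarProofs.eLpNorm_two_pow_two]
    gcongr
    calc eLpNorm (θ₀ ⋆ kk n) 2 volume ≤ (∫⁻ y, ‖kk n y‖ₑ) * eLpNorm θ₀ 2 volume :=
          FunctionSpaces.Torus.eLpNorm_convolution_le hθ₀.1 (hkS n).continuous.aestronglyMeasurable one_le_two
      _ = eLpNorm θ₀ 2 volume := by rw [hk1 n, one_mul]
  -- ### the renormalised dissipation `D M n s = ∫ β_M''(A_n(s)) ‖∇A_n(s)‖²` (measurable form)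
  set D : ℕ → ℕ → ℝ → ℝ := fun M n s => ∫ x, deriv (Calculus.renormDeriv (M : ℝ)) (∫ y, θ s y * kk n (x - y)) *
    ‖(θ s ⋆ FunctionSpaces.Torus.gradient (kk n)) x‖ ^ 2 with hD_def
  have hβ''c : ∀ M : ℕ, Continuous (deriv (Calculus.renormDeriv (M : ℝ))) := fun M =>
    (Calculus.contDiff_renormDeriv (M : ℝ)).continuous_deriv (by simp)
  have hβ''b : ∀ (M : ℕ) (y : ℝ), 0 ≤ deriv (Calculus.renormDeriv (M : ℝ)) y ∧ deriv (Calculus.renormDeriv (M : ℝ)) y ≤ 2 := by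
    intro M y
    rw [Calculus.deriv_renormDeriv]
    refine ⟨by positivity, ?_⟩
    have h1 := Calculus.abs_truncCutoff_le_one (M : ℝ) y
    rw [abs_le] at h1
    nlinarith [(Calculus.truncCutoff (M : ℝ)).nonneg (x := y)]
  have hDm : ∀ (M n : ℕ), AEStronglyMeasurable (D M n) μT := fun M n =>
    h.aestronglyMeasurable_integral_comp_mul_norm_sq (hkS n) (hβ''c M)
  have hD0 : ∀ (M n : ℕ) (s : ℝ), 0 ≤ D M n s := fun M n s =>
    integral_nonneg fun x => mul_nonneg (hβ''b M _).1 (sq_nonneg _)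
  have hDb : ∀ (M n : ℕ), ∃ K : ℝ, ∀ᵐ s ∂μT, D M n s ≤ K := by
    intro M n
    obtain ⟨Ck, hCk⟩ := FunctionSpaces.Torus.exists_forall_norm_le_of_continuous (hkS n).gradient.continuous
    refine ⟨2 * (Ck * C₁) ^ 2, ?_⟩
    filter_upwards [hgood] with s hs
    obtain ⟨⟨hθi, -, -⟩, -, hθ2, hθC, -⟩ := hs
    have hpt : ∀ x, ‖(θ s ⋆ FunctionSpaces.Torus.gradient (kk n)) x‖ ≤ Ck * C₁ := fun x => by
      refine (FunctionSpaces.Torus.norm_convolution_le hθi hCk x).trans (mul_le_mul_of_nonneg_left ?_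
        ((norm_nonneg _).trans (hCk 0)))
      have e : ∫ y, ‖θ s y‖ = ∫ y, |θ s y| := integral_congr_ae (Eventually.of_forall fun y => by
        simp [Real.norm_eq_abs])
      rw [e]
      exact integral_abs_le_of_eLpNorm_le hθ2 hθC
    have hc : Continuous fun x => deriv (Calculus.renormDeriv (M : ℝ)) (∫ y, θ s y * kk n (x - y)) *
        ‖(θ s ⋆ FunctionSpaces.Torus.gradient (kk n)) x‖ ^ 2 := by
      refine ((hβ''c M).comp ?_).mul ((FunctionSpaces.Torus.continuous_convolution hθi (hkS n).gradient.continuous).norm.pow 2)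
      have e : (fun x => ∫ y, θ s y * kk n (x - y)) = θ s ⋆ kk n := funext fun x => (hconv (θ s) n x).symm
      rw [e]
      exact FunctionSpaces.Torus.continuous_convolution hθi (hkS n).continuous
    calc D M n s ≤ ∫ _ : UnitAddTorus d, 2 * (Ck * C₁) ^ 2 := by
          refine integral_mono hc.integrable_unitAddTorus (integrable_const _) fun x => ?_
          dsimp only
          exact mul_le_mul (hβ''b M _).2 (pow_le_pow_left₀ (norm_nonneg _) (hpt x) 2) (sq_nonneg _) zero_le_two
      _ = 2 * (Ck * C₁) ^ 2 := by simp
  have hDi : ∀ (M n : ℕ), Integrable (D M n) μT := by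
    intro M n
    obtain ⟨K, hK⟩ := hDb M n
    refine Integrable.mono' (integrable_const (max K 0)) (hDm M n) ?_
    filter_upwards [hK] with s hs
    rw [Real.norm_eq_abs, abs_of_nonneg (hD0 M n s)]
    exact hs.trans (le_max_left _ _)
  -- `D` versus the spectral dissipation of the truncated mollified slice, a.e.
  have hDe : ∀ (M n : ℕ), ∀ᵐ s ∂μT, ENNReal.ofReal (2 * κ) * eScalarGradNormSq (Calculus.trunc (M : ℝ) ∘ (θ s ⋆ kk n)) =
      ENNReal.ofReal (κ * D M n s) := by
    intro M n
    filter_upwards [hgood] with s hs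
    obtain ⟨⟨hθi, -, -⟩, -⟩ := hs
    have hA : FunctionSpaces.Torus.IsSmooth (θ s ⋆ kk n) := FunctionSpaces.Torus.isSmooth_convolution hθi (hkS n)
    rw [← ofReal_mul_integral_renorm_dissipation hA (M : ℝ) hκ.le, hD_def]
    congr 2
    refine integral_congr_ae (Eventually.of_forall fun x => ?_)
    dsimp only
    rw [← hconv (θ s) n x, FunctionSpaces.Torus.gradient_convolution hθi (hkS n) x]
  have hem : ∀ (M n : ℕ), AEMeasurable (fun s => ENNReal.ofReal (2 * κ) *
      eScalarGradNormSq (Calculus.trunc (M : ℝ) ∘ (θ s ⋆ kk n))) μT := fun M n =>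
    (((hDm M n).aemeasurable.const_mul κ).ennreal_ofReal).congr ((hDe M n).mono fun s hs => hs.symm)
  -- ### **the core estimate**: for a.e. `t`, `ofReal (κ ∫_{(0,t]} D) ≤ a + C_M ∫⁻ ρ_n`
  set Cβ : ℕ → ℝ := fun M => 4 * ((Calculus.truncCutoff (M : ℝ)).rIn + 1) with hCβ
  have hCβ0 : ∀ M, 0 ≤ Cβ M := fun M => by
    have := (Calculus.truncCutoff (M : ℝ)).rIn_pos; rw [hCβ]; positivity
  have hcore : ∀ (M n : ℕ), ∀ᵐ t ∂μT, ENNReal.ofReal (κ * ∫ s in Ioc 0 t, D M n s) ≤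
      a + ENNReal.ofReal (Cβ M) * ∫⁻ s, ρ n s ∂μT := by
    intro M n
    have hβ : ContDiff ℝ 1 (Calculus.renorm (M : ℝ)) := (Calculus.contDiff_renorm (M : ℝ)).of_le (by simp)
    have hβtop : ContDiff ℝ ∞ (Calculus.renorm (M : ℝ)) := Calculus.contDiff_renorm (M : ℝ)
    have hβK := Calculus.lipschitzWith_renorm (M : ℝ)
    have hβ'b : ∀ y, |deriv (Calculus.renorm (M : ℝ)) y| ≤ Cβ M := fun y => by
      rw [Calculus.deriv_renorm]; exact Calculus.abs_renormDeriv_le_const (M : ℝ) y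
    have hβ'c : Continuous (deriv (Calculus.renorm (M : ℝ))) := hβ.continuous_deriv le_rfl
    -- the three time-integrands on `(0,T)`
    set Φ : ℝ → ℝ := fun s => ∫ x, deriv (Calculus.renorm (M : ℝ)) (∫ y, θ s y * kk n (x - y)) *
      ∫ y, θ s y * (-⟪u s y, FunctionSpaces.Torus.gradient (kk n) (x - y)⟫_ℝ + κ * FunctionSpaces.Torus.laplacian (kk n) (x - y))
      with hΦ_def
    set R : ℝ → ℝ := fun s => ∫ x, deriv (Calculus.renorm (M : ℝ)) ((θ s ⋆ kk n) x) *
      ∫ y, θ s y * ⟪u s x - u s y, FunctionSpaces.Torus.gradient (kk n) (x - y)⟫_ℝ with hR_def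
    have hΦi : Integrable Φ μT := (h.integrable_comp_molInt_mul_flux (hkS n) hβ'c hβ'b).integral_prod_left
    -- the slice identity `Φ = R - κ D` a.e.
    have hslice : ∀ᵐ s ∂μT, Φ s = R s - κ * D M n s := by
      filter_upwards [hgood] with s hs
      obtain ⟨⟨hθi, hum, huθ⟩, hdiv, -, -, hui, -⟩ := hs
      have hid := integral_deriv_comp_mul_flux_eq hβtop hθi hui huθ hdiv (hkS n) κ
      have e1 : Φ s = ∫ x, deriv (Calculus.renorm (M : ℝ)) ((θ s ⋆ kk n) x) *
          ∫ y, θ s y * (-⟪u s y, FunctionSpaces.Torus.gradient (kk n) (x - y)⟫_ℝ + κ * FunctionSpaces.Torus.laplacian (kk n) (x - y)) := by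
        simp only [hΦ_def, hconv]
      have e2 : D M n s = ∫ x, deriv (deriv (Calculus.renorm (M : ℝ))) ((θ s ⋆ kk n) x) *
          ‖FunctionSpaces.Torus.gradient (θ s ⋆ kk n) x‖ ^ 2 := by
        simp only [hD_def]
        refine integral_congr_ae (Eventually.of_forall fun x => ?_)
        dsimp only
        rw [Calculus.deriv_renorm, ← hconv (θ s) n x, FunctionSpaces.Torus.gradient_convolution hθi (hkS n) x]
      rw [e1, hid, e2]
    -- the bound `|R| ≤ C_M ρ` a.e.
    have hRle : ∀ᵐ s ∂μT, |R s| ≤ Cβ M * (ρ n s).toReal := by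
      filter_upwards [hρle n, hgood] with s hs hg
      obtain ⟨⟨hθi, hum, -⟩, -⟩ := hg
      have hKc : Continuous fun p : UnitAddTorus d × UnitAddTorus d =>
          FunctionSpaces.Torus.gradient (kk n) (p.1 - p.2) :=
        (hkS n).gradient.continuous.comp (continuous_fst.sub continuous_snd)
      have hP : AEStronglyMeasurable (Function.uncurry fun (x y : UnitAddTorus d) => θ s y * ⟪u s x - u s y,
          FunctionSpaces.Torus.gradient (kk n) (x - y)⟫_ℝ) ((volume : Measure (UnitAddTorus d)).prod volume) :=
        (hθi.aestronglyMeasurable.comp_snd).mul (((hum.comp_fst).sub (hum.comp_snd)).inner hKc.aestronglyMeasurable)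
      have hrm : AEStronglyMeasurable (fun x => ∫ y, θ s y * ⟪u s x - u s y,
          FunctionSpaces.Torus.gradient (kk n) (x - y)⟫_ℝ) volume := hP.integral_prod_right'
      exact abs_integral_mul_le_mul_toReal_lintegral (fun x => hβ'b _) hrm (hs.trans_lt hKρt.lt_top)
    -- `R` is integrable on `(0,T)`
    have hRm : AEStronglyMeasurable R μT := by
      have e : R =ᵐ[μT] fun s => Φ s + κ * D M n s := by
        filter_upwards [hslice] with s hs
        rw [hs]; ring
      exact (hΦi.aestronglyMeasurable.add ((hDm M n).const_mul κ)).congr e.symm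
    have hRi : Integrable R μT := by
      refine Integrable.mono' ((integrable_toReal_of_lintegral_ne_top (hρm n) (hPt n)).const_mul (Cβ M)) hRm ?_
      filter_upwards [hRle] with s hs
      rw [Real.norm_eq_abs]
      exact hs
    -- now the good times
    filter_upwards [h.ae_integral_comp_molInt_eq hθ₀i (hkS n) hβ hβK, ae_restrict_mem measurableSet_Ioo]
      with t hid htT
    have hsub : Ioc 0 t ⊆ Ioo 0 T := Ioc_subset_Ioo_right htT.2
    have hle : (volume : Measure ℝ).restrict (Ioc 0 t) ≤ μT := Measure.restrict_mono_set _ hsub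
    have hΦi' : IntegrableOn Φ (Ioc 0 t) volume := hΦi.mono_measure hle
    have hDi' : IntegrableOn (D M n) (Ioc 0 t) volume := (hDi M n).mono_measure hle
    have hRi' : IntegrableOn R (Ioc 0 t) volume := hRi.mono_measure hle
    -- `∫_{(0,t]} Φ = ∫_{(0,t]} R - κ ∫_{(0,t]} D`
    have hsplit : ∫ s in Ioc 0 t, Φ s = (∫ s in Ioc 0 t, R s) - κ * ∫ s in Ioc 0 t, D M n s := by
      rw [← MeasureTheory.integral_const_mul, ← integral_sub hRi' (hDi'.const_mul κ)]
      exact integral_congr_ae (ae_restrict_of_ae_restrict_of_subset hsub hslice)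
    -- the renormalised identity in real form: `κ ∫ D = ∫ β(A₀) - ∫ β(A(t)) + ∫ R`
    have hidΦ : ∫ x, Calculus.renorm (M : ℝ) (∫ y, θ t y * kk n (x - y)) =
        (∫ x, Calculus.renorm (M : ℝ) (∫ y, θ₀ y * kk n (x - y))) + ∫ s in Ioc 0 t, Φ s := hid
    have hpos : 0 ≤ ∫ x, Calculus.renorm (M : ℝ) (∫ y, θ t y * kk n (x - y)) :=
      integral_nonneg fun x => Calculus.renorm_nonneg _ _
    have hdat : ∫ x, Calculus.renorm (M : ℝ) (∫ y, θ₀ y * kk n (x - y)) ≤ ∫ x, (θ₀ ⋆ kk n) x ^ 2 := by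
      have hc : Continuous (θ₀ ⋆ kk n) := FunctionSpaces.Torus.continuous_convolution hθ₀i (hkS n).continuous
      have e : (fun x => Calculus.renorm (M : ℝ) (∫ y, θ₀ y * kk n (x - y))) = fun x => Calculus.renorm (M : ℝ) ((θ₀ ⋆ kk n) x) :=
        funext fun x => by rw [hconv]
      rw [e]
      exact integral_mono ((Calculus.contDiff_renorm (M : ℝ)).continuous.comp hc).integrable_unitAddTorus
        (hc.pow 2).integrable_unitAddTorus fun x => Calculus.renorm_le_sq _ _
    have hRabs : ∫ s in Ioc 0 t, R s ≤ Cβ M * ∫ s in Ioc 0 t, (ρ n s).toReal := by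
      rw [← MeasureTheory.integral_const_mul]
      refine integral_mono_ae hRi' ((integrable_toReal_of_lintegral_ne_top (hρm n) (hPt n)).const_mul (Cβ M)
        |>.mono_measure hle) ?_
      exact ae_restrict_of_ae_restrict_of_subset hsub (hRle.mono fun s hs => (le_abs_self _).trans hs)
    have hreal : κ * ∫ s in Ioc 0 t, D M n s ≤ (∫ x, (θ₀ ⋆ kk n) x ^ 2) + Cβ M * ∫ s in Ioc 0 t, (ρ n s).toReal := by
      have := hsplit
      linarith
    -- pass to `ℝ≥0∞`
    have hρint : ENNReal.ofReal (∫ s in Ioc 0 t, (ρ n s).toReal) ≤ ∫⁻ s, ρ n s ∂μT :=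
      calc ENNReal.ofReal (∫ s in Ioc 0 t, (ρ n s).toReal)
          ≤ ∫⁻ s in Ioc 0 t, ENNReal.ofReal ((ρ n s).toReal) := ofReal_integral_le_lintegral_ofReal _
        _ ≤ ∫⁻ s in Ioc 0 t, ρ n s := lintegral_mono fun s => ENNReal.ofReal_toReal_le
        _ ≤ ∫⁻ s, ρ n s ∂μT := lintegral_mono' hle le_rfl
    calc ENNReal.ofReal (κ * ∫ s in Ioc 0 t, D M n s)
        ≤ ENNReal.ofReal ((∫ x, (θ₀ ⋆ kk n) x ^ 2) + Cβ M * ∫ s in Ioc 0 t, (ρ n s).toReal) :=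
          ENNReal.ofReal_le_ofReal hreal
      _ ≤ ENNReal.ofReal (∫ x, (θ₀ ⋆ kk n) x ^ 2) + ENNReal.ofReal (Cβ M * ∫ s in Ioc 0 t, (ρ n s).toReal) :=
          ENNReal.ofReal_add_le
      _ ≤ a + ENNReal.ofReal (Cβ M) * ∫⁻ s, ρ n s ∂μT := by
          refine add_le_add (ha0 n) ?_
          rw [ENNReal.ofReal_mul (hCβ0 M)]
          gcongr
  -- ### from a.e. `t` to `t = T`: `∫⁻ 2κ e_{M,n} ≤ a + C_M ∫⁻ ρ_n`
  have hT_bound : ∀ (M n : ℕ), ∫⁻ s, ENNReal.ofReal (2 * κ) * eScalarGradNormSq (Calculus.trunc (M : ℝ) ∘ (θ s ⋆ kk n)) ∂μT ≤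
      a + ENNReal.ofReal (Cβ M) * ∫⁻ s, ρ n s ∂μT := by
    intro M n
    set Rhs : ℝ≥0∞ := a + ENNReal.ofReal (Cβ M) * ∫⁻ s, ρ n s ∂μT with hRhs
    have hRt : Rhs ≠ ⊤ := ENNReal.add_ne_top.2 ⟨hat, ENNReal.mul_ne_top ENNReal.ofReal_ne_top (hPt n)⟩
    have hK : ∀ᵐ t ∂μT, ∫ s in Ioc 0 t, D M n s ≤ Rhs.toReal / κ := by
      filter_upwards [hcore M n] with t ht
      rw [le_div_iff₀ hκ, mul_comm]
      exact (ENNReal.ofReal_le_iff_le_toReal hRt).1 ht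
    have hTT := setIntegral_Ioo_le_of_ae_setIntegral_Ioc_le hT (hDi M n) hK
    rw [le_div_iff₀ hκ, mul_comm] at hTT
    calc ∫⁻ s, ENNReal.ofReal (2 * κ) * eScalarGradNormSq (Calculus.trunc (M : ℝ) ∘ (θ s ⋆ kk n)) ∂μT
        = ∫⁻ s, ENNReal.ofReal (κ * D M n s) ∂μT := lintegral_congr_ae (hDe M n)
      _ = ENNReal.ofReal (κ * ∫ s, D M n s ∂μT) := by
          rw [← MeasureTheory.integral_const_mul, ofReal_integral_eq_lintegral_ofReal ((hDi M n).const_mul κ)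
            (Eventually.of_forall fun s => mul_nonneg hκ.le (hD0 M n s))]
      _ ≤ Rhs := (ENNReal.ofReal_le_ofReal hTT).trans_eq (ENNReal.ofReal_toReal hRt)
  -- ### lower semicontinuity, twice, and Fatou, twice
  have h2κ : (2 : ℝ≥0∞) * ENNReal.ofReal κ = ENNReal.ofReal (2 * κ) := by
    rw [ENNReal.ofReal_mul zero_le_two, ENNReal.ofReal_ofNat]
  -- `n → ∞` at fixed `M`: `S_M ∘ A_n(s) → S_M ∘ θ(s)` in `L²`
  have hE0 : ∀ᵐ s ∂μT, Tendsto (fun n => eLpNorm (θ s ⋆ kk n - θ s) 2 volume) atTop (𝓝 0) := by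
    filter_upwards [hgood] with s hs
    exact FunctionSpaces.Torus.tendsto_eLpNorm_convolution_sub_self hs.2.2.1
      (fun n y => FunctionSpaces.Torus.kernel_nonneg (hε n).le y)
      (fun n => FunctionSpaces.Torus.integral_kernel (hε n) (hε' n)) (fun n => FunctionSpaces.Torus.support_kernel_subset (hε n))
      (fun n => FunctionSpaces.Torus.continuous_kernel (hε n) (hε' n)) hε0
  have hlsc_n : ∀ᵐ s ∂μT, ∀ M : ℕ, ENNReal.ofReal (2 * κ) * eScalarGradNormSq (Calculus.trunc (M : ℝ) ∘ θ s) ≤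
      liminf (fun n => ENNReal.ofReal (2 * κ) * eScalarGradNormSq (Calculus.trunc (M : ℝ) ∘ (θ s ⋆ kk n))) atTop := by
    filter_upwards [hgood, hE0] with s hs hs0 M
    obtain ⟨⟨hθi, -, -⟩, -, hθ2, -⟩ := hs
    have hSc : Continuous (Calculus.trunc (M : ℝ)) := (Calculus.contDiff_trunc (M : ℝ)).continuous
    have hSθi : Integrable (Calculus.trunc (M : ℝ) ∘ θ s) volume := by
      refine Integrable.mono' hθi.norm (hSc.comp_aestronglyMeasurable hθi.aestronglyMeasurable)
        (Eventually.of_forall fun x => ?_)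
      rw [Function.comp_apply, Real.norm_eq_abs, Real.norm_eq_abs]
      exact Calculus.abs_trunc_le _ _
    have hSAi : ∀ n, Integrable (Calculus.trunc (M : ℝ) ∘ (θ s ⋆ kk n)) volume := fun n =>
      (hSc.comp (FunctionSpaces.Torus.continuous_convolution hθi (hkS n).continuous)).integrable_unitAddTorus
    refine mul_eScalarGradNormSq_le_liminf hSθi hSAi ?_ ENNReal.ofReal_ne_top
    refine tendsto_of_tendsto_of_tendsto_of_le_of_le tendsto_const_nhds hs0 (fun n => bot_le) fun n => ?_
    exact eLpNorm_trunc_comp_sub_le (M : ℝ) (θ s ⋆ kk n) (θ s)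
  -- `M → ∞`: `S_M ∘ θ(s) → θ(s)` in `L²`
  have hlsc_M : ∀ᵐ s ∂μT, ENNReal.ofReal (2 * κ) * eScalarGradNormSq (θ s) ≤
      liminf (fun M : ℕ => ENNReal.ofReal (2 * κ) * eScalarGradNormSq (Calculus.trunc (M : ℝ) ∘ θ s)) atTop := by
    filter_upwards [hgood] with s hs
    obtain ⟨⟨hθi, -, -⟩, -, hθ2, -⟩ := hs
    have hSθi : ∀ M : ℕ, Integrable (Calculus.trunc (M : ℝ) ∘ θ s) volume := fun M => by
      refine Integrable.mono' hθi.norm ((Calculus.contDiff_trunc (M : ℝ)).continuous.comp_aestronglyMeasurable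
        hθi.aestronglyMeasurable) (Eventually.of_forall fun x => ?_)
      rw [Function.comp_apply, Real.norm_eq_abs, Real.norm_eq_abs]
      exact Calculus.abs_trunc_le _ _
    refine mul_eScalarGradNormSq_le_liminf hθi hSθi ?_ ENNReal.ofReal_ne_top
    exact tendsto_eLpNorm_trunc_comp_sub hθ2
  -- the limit of the right-hand sides
  have hRHS : ∀ M : ℕ, liminf (fun n => a + ENNReal.ofReal (Cβ M) * ∫⁻ s, ρ n s ∂μT) atTop = a := by
    intro M
    refine Tendsto.liminf_eq ?_
    have h1 := ENNReal.Tendsto.const_mul hP0 (Or.inr ENNReal.ofReal_ne_top : (0 : ℝ≥0∞) ≠ 0 ∨ ENNReal.ofReal (Cβ M) ≠ ⊤)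
    rw [mul_zero] at h1
    simpa using h1.const_add a
  calc 2 * eScalarDissipation κ θ 0 T
      = ∫⁻ s, ENNReal.ofReal (2 * κ) * eScalarGradNormSq (θ s) ∂μT := by
        rw [eScalarDissipation, ← mul_assoc, h2κ, hμT, lintegral_const_mul' _ _ ENNReal.ofReal_ne_top]
    _ ≤ ∫⁻ s, liminf (fun M : ℕ => liminf (fun n => ENNReal.ofReal (2 * κ) *
          eScalarGradNormSq (Calculus.trunc (M : ℝ) ∘ (θ s ⋆ kk n))) atTop) atTop ∂μT := by
        refine lintegral_mono_ae ?_
        filter_upwards [hlsc_M, hlsc_n] with s h1 h2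
        exact h1.trans (liminf_le_liminf (Eventually.of_forall h2))
    _ ≤ liminf (fun M : ℕ => ∫⁻ s, liminf (fun n => ENNReal.ofReal (2 * κ) *
          eScalarGradNormSq (Calculus.trunc (M : ℝ) ∘ (θ s ⋆ kk n))) atTop ∂μT) atTop :=
        lintegral_liminf_le' fun M => aemeasurable_liminf_nat fun n => hem M n
    _ ≤ liminf (fun M : ℕ => liminf (fun n => ∫⁻ s, ENNReal.ofReal (2 * κ) *
          eScalarGradNormSq (Calculus.trunc (M : ℝ) ∘ (θ s ⋆ kk n)) ∂μT) atTop) atTop :=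
        liminf_le_liminf (Eventually.of_forall fun M => lintegral_liminf_le' fun n => hem M n)
    _ ≤ liminf (fun M : ℕ => liminf (fun n => a + ENNReal.ofReal (Cβ M) * ∫⁻ s, ρ n s ∂μT) atTop) atTop :=
        liminf_le_liminf (Eventually.of_forall fun M => liminf_le_liminf (Eventually.of_forall fun n => hT_bound M n))
    _ = a := by simp_rw [hRHS]; exact liminf_const a

/-- **Weak solutions with `L² ∩ Ḣ¹` drift are `L²ₜH¹ₓ`**: under the hypotheses of
`energy_ineq_of_eGradNormSq_le`, `eScalarGradNormSq (θ s) < ∞` for a.e. `s ∈ (0,T)`. [folklore] -/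
theorem ae_eScalarGradNormSq_lt_top (hκ : 0 < κ) (h : IsWeakScalarTransportOn T κ u θ₀ θ)
    (hθ₀ : MemLp θ₀ 2 volume) {G : ℝ≥0}
    (hG : ∀ᵐ t ∂(volume.restrict (Ioo 0 T)), FunctionSpaces.Torus.eGradNormSq (u t) ≤ G)
    (hm : AEMeasurable (fun s => eScalarGradNormSq (θ s)) (volume.restrict (Ioo 0 T))) :
    ∀ᵐ s ∂(volume.restrict (Ioo 0 T)), eScalarGradNormSq (θ s) < ⊤ := by
  have hfin : ∫⁻ s in Ioo 0 T, eScalarGradNormSq (θ s) ≠ ⊤ := by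
    have h1 := energy_ineq_of_eGradNormSq_le hκ h hθ₀ hG
    have hat : ∫⁻ x, ‖θ₀ x‖ₑ ^ 2 ≠ ⊤ := by
      rw [← PassiveScalarProofs.eLpNorm_two_pow_two]
      exact ENNReal.pow_ne_top hθ₀.eLpNorm_ne_top
    have h2 : eScalarDissipation κ θ 0 T ≠ ⊤ := by
      refine ne_top_of_le_ne_top hat ((le_mul_of_one_le_left bot_le one_le_two).trans h1)
    rw [eScalarDissipation] at h2
    intro htop
    rw [htop, ENNReal.mul_top (ENNReal.ofReal_pos.2 hκ).ne'] at h2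
    exact h2 rfl
  exact ae_lt_top' hm hfin

end IsWeakScalarTransportOn

end Torus

end Literature.Analysis.FluidPDE
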